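import Mathlib
import Summits.Ventures.HodgeRepro.Tier4.Target
import Summits.Ventures.HodgeRepro.Tier4.Line2.IsogenyPushforward

/-!
# Tier4/Line2/IsogenyPushforwardCor — the two packaged corollaries of cut (iv) (t4-plan-2 g2, S13234 ask; cut for
t4-L2-p2 g3, S13388 empty plate)

Blind re-derivation cell `pub-hodge-repro`, Tier 4 (README §9–§10), LINE L2.  The three STATEMENTS are the planner's
(t4-plan-2 g2, statements file a653edc8b7d9d71a · 91, S13392) VERBATIM; the proofs are by the prover t4-L2-p2 g3
(tree path `lean/Summits/Ventures/HodgeRepro/Tier4/Line2/IsogenyPushforwardCor.lean`, imports `Tier4.Target` + the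
landed `Tier4.Line2.IsogenyPushforward` p676075 only; every declaration axioms ⊆ {propext, Classical.choice, Quot.sound}).

(1) `isAlbaneseLift_cm_mul` — the pushforward of an Albanese lift onto `ℂ^T/Λ` along MULTIPLICATION BY AN ALGEBRAIC
INTEGER `x ≠ 0` of the CM field `K` (the diagonal scaling `c σ := σ x`) is again an Albanese lift onto `ℂ^T/Λ` when `Λ`
is `O_K`-stable (`IsOFStable`): `c · Λ ⊆ Λ` is `IsOFStable` itself and `σ x ≠ 0` because `σ` is a field embedding.
This is the `Λ' := Λ` case of `isAlbaneseLift_diag_comp` — the form in which L2's re-chosen quadruples (the `ν`-twisted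
corner lifts, which differ from the given ones by the CM isogeny `x·`) land INTO THE GIVEN lattice `Λ i` of the datum,
as `P_T4v3`'s `∃ a'` requires.

(2) `pairing_diag_ne_zero_iff` — the target's integral for the pushed-forward quadruple over ANY `D` is non-zero iff the
original one is, when the four relevant coordinates `c_i ⟨s, hs_i⟩` are non-zero: `integrand_diag` (pointwise) +
`integral_const_mul_ne_zero_iff`.  For `c_i σ := σ x` the constant is `s x · s x · conj(s' x · s' x) ≠ 0`.

Every proof is a few lines from the landed module: (1) is `isAlbaneseLift_diag_comp` with `Λ' := Λ`, `c σ := σ x`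
(`map_ne_zero` for the field embedding `σ`, `IsOFStable` for `c · Λ ⊆ Λ`); (2) is `integrand_diag` rewritten under the
integral sign followed by `integral_const_mul_ne_zero_iff` with the constant `c₁⟨s⟩ c₂⟨s⟩ · conj(c₃⟨s'⟩ c₄⟨s'⟩) ≠ 0`;
(3) is (2) at `c_i σ := σ x`.  No printed input.  HC_CM is NOT proved by anyone in this repository.
-/

set_option autoImplicit false

noncomputable section

namespace Summit.Ventures.HodgeRepro.Tier4

open Matrix MeasureTheory
open scoped ComplexConjugate

section Cor

variable {K : Type*} [Field K]

/-- **Pushforward along multiplication by an algebraic integer `x ≠ 0` of `K`** (the diagonal scaling `c σ := σ x`):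
an Albanese lift onto an `O_K`-stable corner `ℂ^T/Λ` stays an Albanese lift onto the SAME corner. -/
theorem isAlbaneseLift_cm_mul (T : Finset (K →+* ℂ)) (Λ : Submodule ℤ (↥T → ℂ)) (hΛ : IsOFStable T Λ)
    {E : Type*} [Field E] (τ₀ : E →+* ℂ) (C : Matrix (Fin 3) (Fin 3) ℂ) (Γ' : Set (Matrix (Fin 3) (Fin 3) E))
    (a' : (Fin 2 → ℂ) → (↥T → ℂ)) (x : K) (hx : IsIntegral ℤ x) (hx0 : x ≠ 0) :
    IsAlbaneseLift T Λ τ₀ C Γ' a' → IsAlbaneseLift T Λ τ₀ C Γ' (fun z σ => σ.1 x * a' z σ) :=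
  isAlbaneseLift_diag_comp T Λ Λ τ₀ C Γ' a' (fun σ => σ.1 x) (fun σ => (map_ne_zero σ.1).2 hx0)
    (fun v hv => hΛ x hx v hv)

/-- **The target's integral transfers along the diagonal pushforward**: over any `D`, the (P)-integrand of the
pushed-forward quadruple has non-zero integral iff the original one has, provided the four relevant coordinates of the
scalings are non-zero. -/
theorem pairing_diag_ne_zero_iff {E : Type*} [Field E] (τ₀ : E →+* ℂ) (C : Matrix (Fin 3) (Fin 3) ℂ)
    (T₁ T₂ T₃ T₄ : Finset (K →+* ℂ)) (s s' : K →+* ℂ) (hs₁ : s ∈ T₁) (hs₂ : s ∈ T₂) (hs₃ : s' ∈ T₃) (hs₄ : s' ∈ T₄)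
    (h₁ h₂ h₃ h₄ : HeckeElement E) (c₁ : ↥T₁ → ℂ) (c₂ : ↥T₂ → ℂ) (c₃ : ↥T₃ → ℂ) (c₄ : ↥T₄ → ℂ)
    (hc₁ : c₁ ⟨s, hs₁⟩ ≠ 0) (hc₂ : c₂ ⟨s, hs₂⟩ ≠ 0) (hc₃ : c₃ ⟨s', hs₃⟩ ≠ 0) (hc₄ : c₄ ⟨s', hs₄⟩ ≠ 0)
    (a₁ : (Fin 2 → ℂ) → (↥T₁ → ℂ)) (a₂ : (Fin 2 → ℂ) → (↥T₂ → ℂ)) (a₃ : (Fin 2 → ℂ) → (↥T₃ → ℂ))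
    (a₄ : (Fin 2 → ℂ) → (↥T₄ → ℂ)) (D : Set (Fin 2 → ℂ)) :
    (∫ z in D,
      jacDet (comp T₁ s hs₁ (heckeTranslate τ₀ C h₁ (fun z σ => c₁ σ * a₁ z σ)))
        (comp T₂ s hs₂ (heckeTranslate τ₀ C h₂ (fun z σ => c₂ σ * a₂ z σ))) z *
      conj (jacDet (comp T₃ s' hs₃ (heckeTranslate τ₀ C h₃ (fun z σ => c₃ σ * a₃ z σ)))
        (comp T₄ s' hs₄ (heckeTranslate τ₀ C h₄ (fun z σ => c₄ σ * a₄ z σ))) z)) ≠ 0 ↔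
    (∫ z in D,
      jacDet (comp T₁ s hs₁ (heckeTranslate τ₀ C h₁ a₁)) (comp T₂ s hs₂ (heckeTranslate τ₀ C h₂ a₂)) z *
      conj (jacDet (comp T₃ s' hs₃ (heckeTranslate τ₀ C h₃ a₃))
        (comp T₄ s' hs₄ (heckeTranslate τ₀ C h₄ a₄)) z)) ≠ 0 := by
  simp only [integrand_diag]
  exact integral_const_mul_ne_zero_iff
    (mul_ne_zero (mul_ne_zero hc₁ hc₂) ((map_ne_zero (starRingEnd ℂ)).2 (mul_ne_zero hc₃ hc₄))) D _

/-- **The CM-multiplication case of the transfer**: `c_i σ := σ x` for one algebraic integer `x ≠ 0` of `K` — the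
constant is `s x · s x · conj (s' x · s' x) ≠ 0`. -/
theorem pairing_cm_mul_ne_zero_iff {E : Type*} [Field E] (τ₀ : E →+* ℂ) (C : Matrix (Fin 3) (Fin 3) ℂ)
    (T₁ T₂ T₃ T₄ : Finset (K →+* ℂ)) (s s' : K →+* ℂ) (hs₁ : s ∈ T₁) (hs₂ : s ∈ T₂) (hs₃ : s' ∈ T₃) (hs₄ : s' ∈ T₄)
    (h₁ h₂ h₃ h₄ : HeckeElement E) (x : K) (hx0 : x ≠ 0)
    (a₁ : (Fin 2 → ℂ) → (↥T₁ → ℂ)) (a₂ : (Fin 2 → ℂ) → (↥T₂ → ℂ)) (a₃ : (Fin 2 → ℂ) → (↥T₃ → ℂ))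
    (a₄ : (Fin 2 → ℂ) → (↥T₄ → ℂ)) (D : Set (Fin 2 → ℂ)) :
    (∫ z in D,
      jacDet (comp T₁ s hs₁ (heckeTranslate τ₀ C h₁ (fun z σ => σ.1 x * a₁ z σ)))
        (comp T₂ s hs₂ (heckeTranslate τ₀ C h₂ (fun z σ => σ.1 x * a₂ z σ))) z *
      conj (jacDet (comp T₃ s' hs₃ (heckeTranslate τ₀ C h₃ (fun z σ => σ.1 x * a₃ z σ)))
        (comp T₄ s' hs₄ (heckeTranslate τ₀ C h₄ (fun z σ => σ.1 x * a₄ z σ))) z)) ≠ 0 ↔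
    (∫ z in D,
      jacDet (comp T₁ s hs₁ (heckeTranslate τ₀ C h₁ a₁)) (comp T₂ s hs₂ (heckeTranslate τ₀ C h₂ a₂)) z *
      conj (jacDet (comp T₃ s' hs₃ (heckeTranslate τ₀ C h₃ a₃))
        (comp T₄ s' hs₄ (heckeTranslate τ₀ C h₄ a₄)) z)) ≠ 0 :=
  pairing_diag_ne_zero_iff τ₀ C T₁ T₂ T₃ T₄ s s' hs₁ hs₂ hs₃ hs₄ h₁ h₂ h₃ h₄
    (fun σ => σ.1 x) (fun σ => σ.1 x) (fun σ => σ.1 x) (fun σ => σ.1 x)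
    ((map_ne_zero s).2 hx0) ((map_ne_zero s).2 hx0) ((map_ne_zero s').2 hx0) ((map_ne_zero s').2 hx0)
    a₁ a₂ a₃ a₄ D

end Cor

end Summit.Ventures.HodgeRepro.Tier4

end
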